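import Summits.AtomisticToContinuum.HydrodynamicLimit.Theorems.InformationPercolationEngineChaosClosesEulerStressIsotropyD
import HarnessLib

/-!
# Weak stress isotropy in band (crux `ChaosClosesEuler`, stmt-AtomisticToContinuum-15141, line `Sketch`,
# stub `stub_stressIsotropyOfLocalEquilibrium`) — helper E: the pathwise estimate

WHAT. Integration of the pointwise bound of helper C over `x ∈ 𝕋³` (one configuration) and over `s ∈ [0, t]`
(one good orbit):

* `norm_integral_x_le` — `‖∫ₓ g(σ³ρ_r) Σ a_{jk}P_{jk}‖ ≤ 45 G_b A (2θ₁ + ρ₁Θ + c_E ke + ⅔ TL) + A Σ_{jk} E_{jk}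
  + 9A E_E + 18 A G_b TL` (unit cone mass `∫ρ_r = 1`, `∫e_r = ke`, `∫ MpsiC (sqTail M) = TL = (N+1)⁻¹Σ sqTail M vᵢ`,
  `E_ψ = ∫ₓ |h| |err_ψ|`);
* `pathwise_bound` — along a good orbit with `ke ≤ K`, time-integrated mean cubic tail `≤ κ` (level `M ≥ 1`) and
  time-integrated weighted pointwise-local-equilibrium errors `≤ η'`:
  `|∫₀ᵗ∫ₓ g(σ³ρ_r) Σ a_{jk}P_{jk}| ≤ 45 G_b A t (2θ₁ + ρ₁Θ + c_E K) + 48 G_b A κ + 18 A η'`.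

No named fact is invoked.
-/

noncomputable section

namespace Summit.AtomisticToContinuum.HydrodynamicLimit.Theorems.ChaosClosesEulerStressIsotropy

open scoped BigOperators Topology Classical MeasureTheory ENNReal InnerProductSpace
open Filter Set MeasureTheory Function
open Literature.MathematicalPhysics.KineticTheory
open Literature.Analysis.FluidPDE
open Literature.Analysis.FunctionSpaces
open Summit.AtomisticToContinuum.HydrodynamicLimit.Theorems.LocalSecondLawNegative
open Summit.AtomisticToContinuum.HydrodynamicLimit.Theorems.LocalSecondLawLedger
open Summit.AtomisticToContinuum.HydrodynamicLimit.Theorems.LocalSecondLawLedger.L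
  (Mmom rhoC_eq_sum momC_apply_eq_sum momC_eq_sum uC_apply norm_sq_eq_sum)
open Summit.AtomisticToContinuum.HydrodynamicLimit.Theorems.ChaosClosesEulerReduction

variable {N : ℕ}

/-! ## §1 The bulk weight -/

/-- The bulk weight `h = χ · g(σ³ ·)` is continuous. [folklore] -/
theorem continuous_bulkWeight {ρ₁ θ₁ Θ U σ : ℝ} {g : ℝ → ℝ} (hgc : Continuous g) {h : ℝ × V3 × ℝ → ℝ}
    (hh : ∀ p, h p = bulkCut ρ₁ θ₁ Θ U p * g (σ ^ 3 * p.1)) : Continuous h := by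
  have heq : h = fun p => bulkCut ρ₁ θ₁ Θ U p * g (σ ^ 3 * p.1) := funext hh
  rw [heq]
  exact (continuous_bulkCut ρ₁ θ₁ Θ U).mul (hgc.comp (continuous_const.mul continuous_fst))

/-- The bulk weight is bounded by the bound of `g` on `[0, ∞)`. [folklore] -/
theorem abs_bulkWeight_le {ρ₁ θ₁ Θ U σ : ℝ} (hρ₁ : 0 < ρ₁) (hθ₁ : 0 < θ₁) (hΘ : 0 < Θ) (hU : 0 < U)
    (hσ : 0 ≤ σ) {g : ℝ → ℝ} {Gb : ℝ} (hGb0 : 0 ≤ Gb) (hg : ∀ b, 0 ≤ b → |g b| ≤ Gb)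
    {h : ℝ × V3 × ℝ → ℝ} (hh : ∀ p, h p = bulkCut ρ₁ θ₁ Θ U p * g (σ ^ 3 * p.1)) (p : ℝ × V3 × ℝ) :
    |h p| ≤ Gb := by
  rw [hh p]
  by_cases hp : p.1 ≤ ρ₁
  · rw [bulkCut_eq_zero (p := p) hρ₁ hθ₁ hΘ hU (Or.inl hp), zero_mul, abs_zero]; exact hGb0
  · rw [not_le] at hp
    rw [abs_mul, abs_of_nonneg (bulkCut_nonneg _ _ _ _ _)]
    calc bulkCut ρ₁ θ₁ Θ U p * |g (σ ^ 3 * p.1)| ≤ 1 * Gb :=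
          mul_le_mul (bulkCut_le_one _ _ _ _ _) (hg _ (by have := hρ₁.trans hp; positivity)) (abs_nonneg _)
            zero_le_one
      _ = Gb := one_mul _

/-- The bulk weight vanishes on the cold states. [folklore] -/
theorem bulkWeight_eq_zero_of_cold {ρ₁ θ₁ Θ U σ : ℝ} (hρ₁ : 0 < ρ₁) (hθ₁ : 0 < θ₁) (hΘ : 0 < Θ) (hU : 0 < U)
    {g : ℝ → ℝ} {h : ℝ × V3 × ℝ → ℝ} (hh : ∀ p, h p = bulkCut ρ₁ θ₁ Θ U p * g (σ ^ 3 * p.1))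
    (p : ℝ × V3 × ℝ) (hp : p.2.2 ≤ θ₁) : h p = 0 := by
  rw [hh p, bulkCut_eq_zero (p := p) hρ₁ hθ₁ hΘ hU (Or.inr (Or.inl hp)), zero_mul]

/-! ## §2 The `x`-integral of the pointwise bound -/

/-- **The `x`-level estimate.** For one configuration `w`, a traceless `a(x)` with `|a_{jk}| ≤ A`, `|g| ≤ G_b` on
`[0, ∞)`, the bulk weight `h` and a level `M`:
`‖∫ₓ g(σ³ρ_r) Σ a_{jk}P_{jk}‖ ≤ 45G_bA(2θ₁ + ρ₁Θ + c_E ke(w) + ⅔TL) + AΣE_{jk} + 9AE_E + 18AG_b TL`. [folklore] -/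
theorem norm_integral_x_le
    (hMM : ∀ (ρ θ : ℝ) (u : V3), 0 < ρ → 0 < θ →
      let m : Measure V3 := volume.withDensity (fun v => ENNReal.ofReal (localMaxwellian ρ θ u v))
      IsFiniteMeasure m ∧ Integrable (fun v : V3 => ‖v‖ ^ 2) m ∧
      (m Set.univ).toReal = ρ ∧ (∀ j : Fin 3, ∫ v, v j ∂m = ρ * u j) ∧
      (∀ j k : Fin 3, ∫ v, v j * v k ∂m = ρ * (u j * u k + if j = k then θ else 0)) ∧
      (∫ v, ‖v‖ ^ 2 ∂m = ρ * (‖u‖ ^ 2 + 3 * θ)) ∧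
      (∀ ψ : V3 → ℝ, Continuous ψ → (∃ C : ℝ, ∀ v, |ψ v| ≤ C) →
        Integrable ψ m ∧ ∫ v, ψ v ∂m = ρ * ∫ v, ψ v * localMaxwellian 1 θ u v))
    {r : ℝ} (hr : 0 < r) (hr2 : r < 1 / 2) (w : Phase N) {σ : ℝ} (hσ : 0 ≤ σ) (g : ℝ → ℝ) (hgc : Continuous g)
    {Gb : ℝ} (hGb0 : 0 ≤ Gb) (hg : ∀ b, 0 ≤ b → |g b| ≤ Gb) (a : Fin 3 → Fin 3 → T3 → ℝ)
    (htr : ∀ x, ∑ j, a j j x = 0) {A : ℝ} (hA : ∀ j k x, |a j k x| ≤ A) {ρ₁ θ₁ Θ U : ℝ} (hρ₁ : 0 < ρ₁)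
    (hθ₁ : 0 < θ₁) (hΘ : 0 < Θ) (hU : 0 < U) (M : ℝ) (h : ℝ × V3 × ℝ → ℝ)
    (hh : ∀ p, h p = bulkCut ρ₁ θ₁ Θ U p * g (σ ^ 3 * p.1)) :
    ‖∫ x, g (σ ^ 3 * rhoC r w x) * ∑ j, ∑ k, a j k x *
        (MpsiC r w x (fun v => v j * v k) - momC r w x j * momC r w x k / rhoC r w x)‖ ≤
      45 * Gb * A * (2 * θ₁ + ρ₁ * Θ + (4 * M ^ 2 / (9 * Θ) + 8 * M ^ 2 / (3 * U ^ 2)) * ke w +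
        2 / 3 * (((N + 1 : ℕ) : ℝ)⁻¹ * ∑ i, sqTail M (w i).2)) +
      A * (∑ j, ∑ k, ∫ x, |h (rhoC r w x, uC r w x, thetaC r w x)| * |MpsiC r w x (psiJK M j k) -
        rhoC r w x * ∫ v, psiJK M j k v * localMaxwellian 1 (thetaC r w x) (uC r w x) v|) +
      9 * A * (∫ x, |h (rhoC r w x, uC r w x, thetaC r w x)| * |MpsiC r w x (psiE M) -
        rhoC r w x * ∫ v, psiE M v * localMaxwellian 1 (thetaC r w x) (uC r w x) v|) +
      18 * A * Gb * (((N + 1 : ℕ) : ℝ)⁻¹ * ∑ i, sqTail M (w i).2) := by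
  have hA0 : 0 ≤ A := (abs_nonneg _).trans (hA 0 0 0)
  have hhc : Continuous h := continuous_bulkWeight hgc hh
  have hhb : ∀ p, |h p| ≤ Gb := abs_bulkWeight_le hρ₁ hθ₁ hΘ hU hσ hGb0 hg hh
  have hh0 : ∀ p : ℝ × V3 × ℝ, p.2.2 ≤ θ₁ → h p = 0 := bulkWeight_eq_zero_of_cold hρ₁ hθ₁ hΘ hU hh
  -- the four pieces of the majorant
  set cE := 4 * M ^ 2 / (9 * Θ) + 8 * M ^ 2 / (3 * U ^ 2) with hcE
  set B₁ : T3 → ℝ := fun x => 45 * Gb * A * (2 * θ₁ * rhoC r w x + ρ₁ * Θ + cE * kinC r w x +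
    2 / 3 * MpsiC r w x (sqTail M)) with hB₁
  set PJ : Fin 3 → Fin 3 → T3 → ℝ := fun j k x => |h (rhoC r w x, uC r w x, thetaC r w x)| *
    |MpsiC r w x (psiJK M j k) - rhoC r w x * ∫ v, psiJK M j k v * localMaxwellian 1 (thetaC r w x) (uC r w x) v|
    with hPJ
  set PE : T3 → ℝ := fun x => |h (rhoC r w x, uC r w x, thetaC r w x)| *
    |MpsiC r w x (psiE M) - rhoC r w x * ∫ v, psiE M v * localMaxwellian 1 (thetaC r w x) (uC r w x) v| with hPE
  set B₂ : T3 → ℝ := fun x => A * ∑ j, ∑ k, PJ j k x with hB₂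
  set B₃ : T3 → ℝ := fun x => 9 * A * PE x with hB₃
  set B₄ : T3 → ℝ := fun x => 18 * A * Gb * MpsiC r w x (sqTail M) with hB₄
  -- the pointwise bound
  have hpt : ∀ x, ‖g (σ ^ 3 * rhoC r w x) * ∑ j, ∑ k, a j k x *
      (MpsiC r w x (fun v => v j * v k) - momC r w x j * momC r w x k / rhoC r w x)‖ ≤
      B₁ x + B₂ x + B₃ x + B₄ x := by
    intro x
    have hgx : |g (σ ^ 3 * rhoC r w x)| ≤ Gb := hg _ (mul_nonneg (pow_nonneg hσ 3) (rhoC_nonneg hr w x))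
    have h1 := abs_weighted_sum_Pm_le hMM hr w x g hGb0 hgx (fun j k => a j k x) (htr x) (fun j k => hA j k x)
      hρ₁ hθ₁ hΘ hU M h hh
    simp only [Mmom_eq_MpsiC] at h1
    rw [Real.norm_eq_abs]
    exact h1
  -- integrability of the pieces
  have hiB₁ : Integrable B₁ volume :=
    integrable_of_continuous_T3 (continuous_const.mul ((((continuous_const.mul (continuous_rhoC r w)).add
      continuous_const).add (continuous_const.mul (continuous_kinC r w))).add
      (continuous_const.mul (continuous_MpsiC r w _))))
  have hiPJ : ∀ j k, Integrable (PJ j k) volume := fun j k =>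
    integrable_weighted_pleErr hMM hr w (continuous_psiJK M j k) (abs_psiJK_le M j k) hhc hhb hθ₁ hh0
  have hiPE : Integrable PE volume :=
    integrable_weighted_pleErr hMM hr w (continuous_psiE M) (abs_psiE_le M) hhc hhb hθ₁ hh0
  have hiS : Integrable (fun x => ∑ j, ∑ k, PJ j k x) volume :=
    integrable_finsetSum _ fun j _ => integrable_finsetSum _ fun k _ => hiPJ j k
  have hiB₂ : Integrable B₂ volume := hiS.const_mul A
  have hiB₃ : Integrable B₃ volume := hiPE.const_mul _
  have hiB₄ : Integrable B₄ volume := (integrable_of_continuous_T3 (continuous_MpsiC r w _)).const_mul _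
  have hiB12 : Integrable (fun x => B₁ x + B₂ x) volume := hiB₁.add hiB₂
  have hiB123 : Integrable (fun x => B₁ x + B₂ x + B₃ x) volume := hiB12.add hiB₃
  have hiB : Integrable (fun x => B₁ x + B₂ x + B₃ x + B₄ x) volume := hiB123.add hiB₄
  -- the integrals of the pieces
  have hTL : ∫ x, MpsiC r w x (sqTail M) = ((N + 1 : ℕ) : ℝ)⁻¹ * ∑ i, sqTail M (w i).2 :=
    integral_MpsiC hr hr2 w (sqTail M)
  have hI₁ : ∫ x, B₁ x = 45 * Gb * A * (2 * θ₁ + ρ₁ * Θ + cE * ke w +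
      2 / 3 * (((N + 1 : ℕ) : ℝ)⁻¹ * ∑ i, sqTail M (w i).2)) := by
    have i1 : Integrable (fun x => 2 * θ₁ * rhoC r w x) volume :=
      (integrable_of_continuous_T3 (continuous_rhoC r w)).const_mul _
    have i2 : Integrable (fun _ : T3 => ρ₁ * Θ) volume := integrable_const _
    have i3 : Integrable (fun x => cE * kinC r w x) volume :=
      (integrable_of_continuous_T3 (continuous_kinC r w)).const_mul _
    have i4 : Integrable (fun x => 2 / 3 * MpsiC r w x (sqTail M)) volume :=
      (integrable_of_continuous_T3 (continuous_MpsiC r w _)).const_mul _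
    have i12 : Integrable (fun x => 2 * θ₁ * rhoC r w x + ρ₁ * Θ) volume := i1.add i2
    have i123 : Integrable (fun x => 2 * θ₁ * rhoC r w x + ρ₁ * Θ + cE * kinC r w x) volume := i12.add i3
    have j1 : ∫ x, 2 * θ₁ * rhoC r w x = 2 * θ₁ := by
      rw [integral_const_mul, integral_rhoC_eq_one hr hr2 w, mul_one]
    have j2 : ∫ _ : T3, ρ₁ * Θ = ρ₁ * Θ := by rw [integral_const, probReal_univ, one_smul]
    have j3 : ∫ x, cE * kinC r w x = cE * ke w := by rw [integral_const_mul, integral_kinC_eq_ke hr hr2 w]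
    have j4 : ∫ x, 2 / 3 * MpsiC r w x (sqTail M) = 2 / 3 * (((N + 1 : ℕ) : ℝ)⁻¹ * ∑ i, sqTail M (w i).2) := by
      rw [integral_const_mul, hTL]
    rw [hB₁, integral_const_mul, integral_add i123 i4, integral_add i12 i3, integral_add i1 i2, j1, j2, j3, j4]
  have hI₂ : ∫ x, B₂ x = A * ∑ j, ∑ k, ∫ x, PJ j k x := by
    rw [hB₂, integral_const_mul, integral_finsetSum _ fun j _ => integrable_finsetSum _ fun k _ => hiPJ j k]
    congr 1
    refine Finset.sum_congr rfl fun j _ => ?_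
    rw [integral_finsetSum _ fun k _ => hiPJ j k]
  have hI₃ : ∫ x, B₃ x = 9 * A * ∫ x, PE x := by rw [hB₃, integral_const_mul]
  have hI₄ : ∫ x, B₄ x = 18 * A * Gb * (((N + 1 : ℕ) : ℝ)⁻¹ * ∑ i, sqTail M (w i).2) := by
    rw [hB₄, integral_const_mul, hTL]
  have hI : ∫ x, (B₁ x + B₂ x + B₃ x + B₄ x) = (∫ x, B₁ x) + (∫ x, B₂ x) + (∫ x, B₃ x) + ∫ x, B₄ x := by
    rw [integral_add hiB123 hiB₄, integral_add hiB12 hiB₃, integral_add hiB₁ hiB₂]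
  have hmain := norm_integral_le_of_norm_le hiB (ae_of_all _ hpt)
  rw [hI, hI₁, hI₂, hI₃, hI₄] at hmain
  simpa only [hPJ, hPE] using hmain

/-! ## §3 The pathwise estimate along a good orbit -/

/-- **THE PATHWISE ESTIMATE.** Along a good orbit of a hard-sphere flow, with `0 < r < 1/2`, `0 ≤ t`, a traceless
continuous `a` with `|a_{jk}| ≤ A` on `[0, t] × 𝕋³`, `|g| ≤ G_b` on `[0, ∞)`, the bulk weight `h = χ·g(σ³·)`, a level
`M ≥ 1`, the energy bound `ke z ≤ K`, the time-integrated mean cubic tail `≤ κ` and the ten time-integrated weighted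
pointwise-local-equilibrium errors `≤ η'`:
`|∫_{[0,t]}∫ₓ g(σ³ρ_r) Σ a_{jk}P_{jk}| ≤ 45G_bA t(2θ₁ + ρ₁Θ + c_E K) + 48G_bAκ + 18Aη'`. [folklore] -/
theorem pathwise_bound
    (hMM : ∀ (ρ θ : ℝ) (u : V3), 0 < ρ → 0 < θ →
      let m : Measure V3 := volume.withDensity (fun v => ENNReal.ofReal (localMaxwellian ρ θ u v))
      IsFiniteMeasure m ∧ Integrable (fun v : V3 => ‖v‖ ^ 2) m ∧
      (m Set.univ).toReal = ρ ∧ (∀ j : Fin 3, ∫ v, v j ∂m = ρ * u j) ∧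
      (∀ j k : Fin 3, ∫ v, v j * v k ∂m = ρ * (u j * u k + if j = k then θ else 0)) ∧
      (∫ v, ‖v‖ ^ 2 ∂m = ρ * (‖u‖ ^ 2 + 3 * θ)) ∧
      (∀ ψ : V3 → ℝ, Continuous ψ → (∃ C : ℝ, ∀ v, |ψ v| ≤ C) →
        Integrable ψ m ∧ ∫ v, ψ v ∂m = ρ * ∫ v, ψ v * localMaxwellian 1 θ u v))
    {σ : ℝ} (hσ : 0 ≤ σ) {ε : ℝ} (Φ : HardSphereFlow (Torus.geometry (Fin 3)) ε (N + 1)) {z : Phase N}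
    (hz : z ∈ Φ.good) {r : ℝ} (hr : 0 < r) (hr2 : r < 1 / 2) {t : ℝ} (ht : 0 ≤ t)
    (a : Fin 3 → Fin 3 → ℝ × T3 → ℝ) (htr : ∀ p, ∑ j, a j j p = 0) {A : ℝ} (hA0 : 0 ≤ A)
    (hA : ∀ j k, ∀ s ∈ Set.Icc 0 t, ∀ x, |a j k (s, x)| ≤ A) (g : ℝ → ℝ) (hgc : Continuous g) {Gb : ℝ}
    (hGb0 : 0 ≤ Gb) (hg : ∀ b, 0 ≤ b → |g b| ≤ Gb) {ρ₁ θ₁ Θ U : ℝ} (hρ₁ : 0 < ρ₁) (hθ₁ : 0 < θ₁) (hΘ : 0 < Θ)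
    (hU : 0 < U) {M : ℝ} (hM : 1 ≤ M) (h : ℝ × V3 × ℝ → ℝ)
    (hh : ∀ p, h p = bulkCut ρ₁ θ₁ Θ U p * g (σ ^ 3 * p.1)) {K : ℝ} (hK : ke z ≤ K) {κ : ℝ}
    (hκ : ∫ s in Set.Icc 0 t, ((N : ℝ) + 1)⁻¹ * ∑ i, cubeTail M ((Φ.flow s z) i).2 ≤ κ) {η' : ℝ}
    (hJ : ∀ j k, ∫ s in Set.Icc 0 t, ∫ x, |h (rhoC r (Φ.flow s z) x, uC r (Φ.flow s z) x, thetaC r (Φ.flow s z) x)| *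
      |MpsiC r (Φ.flow s z) x (psiJK M j k) - rhoC r (Φ.flow s z) x *
        ∫ v, psiJK M j k v * localMaxwellian 1 (thetaC r (Φ.flow s z) x) (uC r (Φ.flow s z) x) v| ≤ η')
    (hE : ∫ s in Set.Icc 0 t, ∫ x, |h (rhoC r (Φ.flow s z) x, uC r (Φ.flow s z) x, thetaC r (Φ.flow s z) x)| *
      |MpsiC r (Φ.flow s z) x (psiE M) - rhoC r (Φ.flow s z) x *
        ∫ v, psiE M v * localMaxwellian 1 (thetaC r (Φ.flow s z) x) (uC r (Φ.flow s z) x) v| ≤ η') :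
    |∫ s in Set.Icc 0 t, ∫ x, g (σ ^ 3 * rhoC r (Φ.flow s z) x) * ∑ j, ∑ k, a j k (s, x) *
        (MpsiC r (Φ.flow s z) x (fun v => v j * v k) -
          momC r (Φ.flow s z) x j * momC r (Φ.flow s z) x k / rhoC r (Φ.flow s z) x)| ≤
      45 * Gb * A * t * (2 * θ₁ + ρ₁ * Θ + (4 * M ^ 2 / (9 * Θ) + 8 * M ^ 2 / (3 * U ^ 2)) * K) +
      48 * Gb * A * κ + 18 * A * η' := by
  have hhc : Continuous h := continuous_bulkWeight hgc hh
  have hhb : ∀ p, |h p| ≤ Gb := abs_bulkWeight_le hρ₁ hθ₁ hΘ hU hσ hGb0 hg hh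
  have hh0 : ∀ p : ℝ × V3 × ℝ, p.2.2 ≤ θ₁ → h p = 0 := bulkWeight_eq_zero_of_cold hρ₁ hθ₁ hΘ hU hh
  set cE := 4 * M ^ 2 / (9 * Θ) + 8 * M ^ 2 / (3 * U ^ 2) with hcE
  have hcE0 : 0 ≤ cE := by positivity
  -- the time profiles
  set TL : ℝ → ℝ := fun s => ((N + 1 : ℕ) : ℝ)⁻¹ * ∑ i, sqTail M ((Φ.flow s z) i).2 with hTL
  set TL3 : ℝ → ℝ := fun s => ((N : ℝ) + 1)⁻¹ * ∑ i, cubeTail M ((Φ.flow s z) i).2 with hTL3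
  set EJ : Fin 3 → Fin 3 → ℝ → ℝ := fun j k s => ∫ x, |h (rhoC r (Φ.flow s z) x, uC r (Φ.flow s z) x,
      thetaC r (Φ.flow s z) x)| * |MpsiC r (Φ.flow s z) x (psiJK M j k) - rhoC r (Φ.flow s z) x *
        ∫ v, psiJK M j k v * localMaxwellian 1 (thetaC r (Φ.flow s z) x) (uC r (Φ.flow s z) x) v| with hEJ
  set EE : ℝ → ℝ := fun s => ∫ x, |h (rhoC r (Φ.flow s z) x, uC r (Φ.flow s z) x, thetaC r (Φ.flow s z) x)| *
      |MpsiC r (Φ.flow s z) x (psiE M) - rhoC r (Φ.flow s z) x *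
        ∫ v, psiE M v * localMaxwellian 1 (thetaC r (Φ.flow s z) x) (uC r (Φ.flow s z) x) v| with hEE
  set F : ℝ → ℝ := fun s => ∫ x, g (σ ^ 3 * rhoC r (Φ.flow s z) x) * ∑ j, ∑ k, a j k (s, x) *
      (MpsiC r (Φ.flow s z) x (fun v => v j * v k) -
        momC r (Φ.flow s z) x j * momC r (Φ.flow s z) x k / rhoC r (Φ.flow s z) x) with hF
  set C₀ := 45 * Gb * A * (2 * θ₁ + ρ₁ * Θ + cE * ke z) with hC₀
  set Q : ℝ → ℝ := fun s => C₀ + 48 * Gb * A * TL s + A * ∑ j, ∑ k, EJ j k s + 9 * A * EE s with hQ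
  -- Step 1: the `x`-level estimate at every instant of the window
  have step1 : ∀ s ∈ Set.Icc 0 t, ‖F s‖ ≤ Q s := by
    intro s hs
    have h1 := norm_integral_x_le hMM hr hr2 (Φ.flow s z) hσ g hgc hGb0 hg (fun j k x => a j k (s, x))
      (fun x => htr (s, x)) (fun j k x => hA j k s hs x) hρ₁ hθ₁ hΘ hU M h hh
    rw [ke_flow_eq' Φ hz s] at h1
    simp only [hF, hQ, hC₀, hTL, hEJ, hEE]
    linarith
  -- Step 2: integrability of the majorant on the window
  have hiTL : IntegrableOn TL (Set.Icc 0 t) volume := integrableOn_mean_sqTail Φ M hz 0 t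
  have hiTL3 : IntegrableOn TL3 (Set.Icc 0 t) volume := integrableOn_mean_cubeTail Φ M hz 0 t
  have hiEJ : ∀ j k, IntegrableOn (EJ j k) (Set.Icc 0 t) volume := fun j k =>
    integrableOn_weighted_pleErr hMM Φ hz hr (continuous_psiJK M j k) (abs_psiJK_le M j k) hhc hhb hθ₁ hh0 0 t
  have hiEE : IntegrableOn EE (Set.Icc 0 t) volume :=
    integrableOn_weighted_pleErr hMM Φ hz hr (continuous_psiE M) (abs_psiE_le M) hhc hhb hθ₁ hh0 0 t
  have hiC : IntegrableOn (fun _ : ℝ => C₀) (Set.Icc 0 t) volume :=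
    integrableOn_const (by rw [Real.volume_Icc]; exact ENNReal.ofReal_ne_top)
  have hiS : IntegrableOn (fun s => ∑ j, ∑ k, EJ j k s) (Set.Icc 0 t) volume :=
    integrable_finsetSum _ fun j _ => integrable_finsetSum _ fun k _ => hiEJ j k
  have hi1 : IntegrableOn (fun s => 48 * Gb * A * TL s) (Set.Icc 0 t) volume := hiTL.const_mul _
  have hi2 : IntegrableOn (fun s => A * ∑ j, ∑ k, EJ j k s) (Set.Icc 0 t) volume := hiS.const_mul _
  have hi3 : IntegrableOn (fun s => 9 * A * EE s) (Set.Icc 0 t) volume := hiEE.const_mul _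
  have hiQ1 : IntegrableOn (fun s => C₀ + 48 * Gb * A * TL s) (Set.Icc 0 t) volume := hiC.add hi1
  have hiQ2 : IntegrableOn (fun s => C₀ + 48 * Gb * A * TL s + A * ∑ j, ∑ k, EJ j k s) (Set.Icc 0 t) volume :=
    hiQ1.add hi2
  have hiQ : IntegrableOn Q (Set.Icc 0 t) volume := hiQ2.add hi3
  -- Step 3: the window integral of the majorant
  have step2 : ‖∫ s in Set.Icc 0 t, F s‖ ≤ ∫ s in Set.Icc 0 t, Q s :=
    norm_integral_le_of_norm_le hiQ (ae_restrict_of_forall_mem measurableSet_Icc step1)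
  have hIQ : ∫ s in Set.Icc 0 t, Q s = C₀ * t + 48 * Gb * A * (∫ s in Set.Icc 0 t, TL s) +
      A * (∑ j, ∑ k, ∫ s in Set.Icc 0 t, EJ j k s) + 9 * A * ∫ s in Set.Icc 0 t, EE s := by
    have e1 : ∫ s in Set.Icc 0 t, Q s = (∫ s in Set.Icc 0 t, (C₀ + 48 * Gb * A * TL s + A * ∑ j, ∑ k, EJ j k s)) +
        ∫ s in Set.Icc 0 t, 9 * A * EE s := integral_add hiQ2 hi3
    have e2 : ∫ s in Set.Icc 0 t, (C₀ + 48 * Gb * A * TL s + A * ∑ j, ∑ k, EJ j k s) =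
        (∫ s in Set.Icc 0 t, (C₀ + 48 * Gb * A * TL s)) + ∫ s in Set.Icc 0 t, A * ∑ j, ∑ k, EJ j k s :=
      integral_add hiQ1 hi2
    have e3 : ∫ s in Set.Icc 0 t, (C₀ + 48 * Gb * A * TL s) =
        (∫ _ in Set.Icc 0 t, C₀) + ∫ s in Set.Icc 0 t, 48 * Gb * A * TL s := integral_add hiC hi1
    have e4 : ∫ _ in Set.Icc 0 t, C₀ = C₀ * t := by
      rw [setIntegral_const, measureReal_def, Real.volume_Icc, ENNReal.toReal_ofReal (by linarith), smul_eq_mul,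
        sub_zero, mul_comm]
    have e5 : ∫ s in Set.Icc 0 t, A * ∑ j, ∑ k, EJ j k s = A * ∑ j, ∑ k, ∫ s in Set.Icc 0 t, EJ j k s := by
      rw [integral_const_mul, integral_finsetSum _ fun j _ => integrable_finsetSum _ fun k _ => hiEJ j k]
      congr 1
      refine Finset.sum_congr rfl fun j _ => ?_
      rw [integral_finsetSum _ fun k _ => hiEJ j k]
    have e6 : ∫ s in Set.Icc 0 t, 48 * Gb * A * TL s = 48 * Gb * A * ∫ s in Set.Icc 0 t, TL s :=
      integral_const_mul _ _
    have e7 : ∫ s in Set.Icc 0 t, 9 * A * EE s = 9 * A * ∫ s in Set.Icc 0 t, EE s := integral_const_mul _ _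
    rw [e1, e2, e3, e4, e5, e6, e7]
  -- Step 4: the bounds of the four window integrals
  have hTLle : ∫ s in Set.Icc 0 t, TL s ≤ κ := by
    have hN : ((N : ℝ) + 1) = ((N + 1 : ℕ) : ℝ) := by push_cast; ring
    have h1 : ∫ s in Set.Icc 0 t, TL s ≤ ∫ s in Set.Icc 0 t, TL3 s := by
      refine setIntegral_mono_on hiTL hiTL3 measurableSet_Icc fun s _ => ?_
      simp only [hTL, hTL3, hN]
      exact mean_sqTail_le_mean_cubeTail hM _
    exact h1.trans hκ
  have hEJle : ∑ j, ∑ k, ∫ s in Set.Icc 0 t, EJ j k s ≤ 9 * η' :=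
    calc ∑ j, ∑ k, ∫ s in Set.Icc 0 t, EJ j k s ≤ ∑ _j : Fin 3, ∑ _k : Fin 3, η' :=
          Finset.sum_le_sum fun j _ => Finset.sum_le_sum fun k _ => hJ j k
      _ = 9 * η' := by simp only [Finset.sum_const, Finset.card_univ, Fintype.card_fin, nsmul_eq_mul]; ring
  have hC₀le : C₀ * t ≤ 45 * Gb * A * t * (2 * θ₁ + ρ₁ * Θ + cE * K) := by
    have h1 : cE * ke z ≤ cE * K := mul_le_mul_of_nonneg_left hK hcE0
    have h2 : C₀ ≤ 45 * Gb * A * (2 * θ₁ + ρ₁ * Θ + cE * K) := by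
      rw [hC₀]
      exact mul_le_mul_of_nonneg_left (by linarith) (by positivity)
    calc C₀ * t ≤ 45 * Gb * A * (2 * θ₁ + ρ₁ * Θ + cE * K) * t := mul_le_mul_of_nonneg_right h2 ht
      _ = _ := by ring
  have hGA : 0 ≤ 48 * Gb * A := by positivity
  have f1 : 48 * Gb * A * ∫ s in Set.Icc 0 t, TL s ≤ 48 * Gb * A * κ := mul_le_mul_of_nonneg_left hTLle hGA
  have f2 : A * ∑ j, ∑ k, ∫ s in Set.Icc 0 t, EJ j k s ≤ A * (9 * η') := mul_le_mul_of_nonneg_left hEJle hA0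
  have f3 : 9 * A * ∫ s in Set.Icc 0 t, EE s ≤ 9 * A * η' := mul_le_mul_of_nonneg_left hE (by positivity)
  have f4 : |∫ s in Set.Icc 0 t, F s| ≤ ∫ s in Set.Icc 0 t, Q s := by
    rw [← Real.norm_eq_abs]; exact step2
  rw [hIQ] at f4
  linarith

/-! ## §4 Registered sub-goal -/

/-- **Registered sub-goal `stub_stressIsotropyWeight` (helper E of `stub_stressIsotropyOfLocalEquilibrium`): the bulk
weight `h = χ · g(σ³ ·)` fed to pointwise local equilibrium is continuous.** [folklore] -/
theorem stub_stressIsotropyWeight : ∀ {ρ₁ θ₁ Θ U σ : ℝ} {g : ℝ → ℝ}, Continuous g → ∀ {h : ℝ × V3 × ℝ → ℝ}, (∀ p, h p = bulkCut ρ₁ θ₁ Θ U p * g (σ ^ 3 * p.1)) → Continuous h :=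
  fun hgc _ hh => continuous_bulkWeight hgc hh

end Summit.AtomisticToContinuum.HydrodynamicLimit.Theorems.ChaosClosesEulerStressIsotropy

end
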